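import Mathlib
import Literature.MathematicalPhysics.QuantumLattice.HubbardEffectiveActionCT

/-!
# The seed-slice covariance lives above `Λ₀/2` (stub `stub_seedSliceCovarianceSupport`, S8 of line
# `seed-strength-flow`, crux `SeededBrokenRegimeBoseFermiPinned` = stmt-HubbardSuperconductivity-14047)

Companion of S3 (`…SeedSliceCovarianceBound`): the covariance above scale `Λ₀` in a counterterm frame,
`C^{>Λ₀}_h(X,Y) = ½(w(k_X) + w(k_Y)) · C^K_h(X,Y)` with Salmhofer's `h`-FREE weight `w = χ₂((ω² + e_K²)/Λ₀²)`, does not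
depend on the seed `h` at any entry whose first label lies at or below `Λ₀/2` (`ω_X² + e_K(k_X)² ≤ Λ₀²/4`): there `w(k_X) = 0`
(`χ₂ = 0` on `[0, ¼]`), and `C^K(X,Y) ≠ 0` forces `ω_Y² + e_Y² = ω_X² + e_X²` (momentum conservation up to the Nambu reflection,
under which `ω² + e_K²` is invariant), hence `w(k_Y) = 0` as well.  So the seed-slice covariance
`C^{>Λ₀}_h − C^{>Λ₀}_{h₀}` of the line's one convolution (S2) is supported on the modes above `Λ₀/2`.
Source: folklore bookkeeping on the tree's `hubbardCovAboveCT` / `nambuTwoPointCT` / `toNambu` (Salmhofer 1999 (4.70)–(4.71)).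
-/

set_option linter.dupNamespace false -- `Summit.<S>.<S>` doubles the summit name (tree convention)

namespace Summit.HubbardSuperconductivity.HubbardSuperconductivity.Theorems.AposterioriCapRgSeededBrokenRegimeBoseFermiPinned

open Literature.MathematicalPhysics.QuantumLattice Literature.Probability.LatticeModels GrassmannAlgebra

/-- `ω² + e_K²` is invariant under the Nambu relabelling of a field label. [folklore] -/
theorem den_toNambu_eq {L M : ℕ} [NeZero L] (β μ : ℝ) (K : TrigPolyC4v) (X : HubbardFieldIdx L M) :
    matsubaraFreq β M (toNambu X).1.1.1 ^ 2 + nambuXiCT L μ K (toNambu X).1.1.2 ^ 2 =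
      matsubaraFreq β M X.1.1.1 ^ 2 + nambuXiCT L μ K X.1.1.2 ^ 2 := by
  unfold toNambu
  split_ifs with h
  · rfl
  · simp only [FreqMomentum.neg, matsubaraFreq_rev, neg_sq, nambuXiCT_neg]

/-- If the `if`-condition of `nambuTwoPointCT` links two Nambu labels, their `ω² + e_K²` agree; otherwise the table
entry vanishes for every seed. [folklore] -/
theorem nambuTwoPointCT_eq_zero_of_den_ne {L M : ℕ} [NeZero L] (β μ h : ℝ) (K : TrigPolyC4v)
    (A B : (FreqMomentum L M × Fin 2) × Fin 2)
    (hne : matsubaraFreq β M A.1.1.1 ^ 2 + nambuXiCT L μ K A.1.1.2 ^ 2 ≠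
      matsubaraFreq β M B.1.1.1 ^ 2 + nambuXiCT L μ K B.1.1.2 ^ 2) :
    nambuTwoPointCT L M β μ h K A B = 0 := by
  unfold nambuTwoPointCT
  split_ifs with hc
  · exact absurd (by rw [hc.2.2]) hne
  · rfl

/-- The CT weight vanishes at a label at or below `Λ₀/2`. [folklore] -/
theorem hubbardCutoffWeightCT_eq_zero_of_le {L M : ℕ} (β μ Λ₀ : ℝ) (K : TrigPolyC4v) (k : FreqMomentum L M)
    (hk : matsubaraFreq β M k.1 ^ 2 + nambuXiCT L μ K k.2 ^ 2 ≤ Λ₀ ^ 2 / 4) :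
    hubbardCutoffWeightCT L M β μ K Λ₀ k = 0 := by
  unfold hubbardCutoffWeightCT
  apply salmhoferCutoff_of_le
  rcases eq_or_ne Λ₀ 0 with h0 | h0
  · simp [h0]
  · have hpos : 0 < Λ₀ ^ 2 := by positivity
    rw [div_le_iff₀ hpos]
    linarith

/-- **S8 (`SeedSliceCovarianceSupport`)**: at an entry whose first label lies at or below `Λ₀/2`, the covariance above
scale `Λ₀` does not depend on the seed — the seed-slice covariance of the line's one convolution is supported on the
modes above `Λ₀/2`. [folklore] -/
theorem stub_seedSliceCovarianceSupport :
    ∀ (L M : ℕ) [NeZero L] (β μ h h₀ : ℝ) (K : TrigPolyC4v) (Λ₀ : ℝ) (X Y : HubbardFieldIdx L M),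
      matsubaraFreq β M (momentumOf L M X).1 ^ 2 + nambuXiCT L μ K (momentumOf L M X).2 ^ 2 ≤ Λ₀ ^ 2 / 4 →
        hubbardCovAboveCT L M β μ h K Λ₀ X Y = hubbardCovAboveCT L M β μ h₀ K Λ₀ X Y := by
  intro L M _ β μ h h₀ K Λ₀ X Y hX
  have hwX : hubbardCutoffWeightCT L M β μ K Λ₀ (momentumOf L M X) = 0 :=
    hubbardCutoffWeightCT_eq_zero_of_le β μ Λ₀ K _ hX
  -- either the second weight vanishes too, or the two labels are not linked and the covariance entry is `0`
  by_cases hD : matsubaraFreq β M X.1.1.1 ^ 2 + nambuXiCT L μ K X.1.1.2 ^ 2 =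
      matsubaraFreq β M Y.1.1.1 ^ 2 + nambuXiCT L μ K Y.1.1.2 ^ 2
  · have hwY : hubbardCutoffWeightCT L M β μ K Λ₀ (momentumOf L M Y) = 0 := by
      refine hubbardCutoffWeightCT_eq_zero_of_le β μ Λ₀ K _ ?_
      simpa [momentumOf, hD] using hX
    simp only [hubbardCovAboveCT, Matrix.of_apply, hwX, hwY, add_zero, zero_div, Complex.ofReal_zero, zero_mul]
  · have hA : ∀ h', nambuTwoPointCT L M β μ h' K (toNambu X) (toNambu Y) = 0 := fun h' =>
      nambuTwoPointCT_eq_zero_of_den_ne β μ h' K _ _ (by rwa [den_toNambu_eq, den_toNambu_eq])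
    have hB : ∀ h', nambuTwoPointCT L M β μ h' K (toNambu Y) (toNambu X) = 0 := fun h' =>
      nambuTwoPointCT_eq_zero_of_den_ne β μ h' K _ _ (by rw [den_toNambu_eq, den_toNambu_eq]; exact Ne.symm hD)
    simp only [hubbardCovAboveCT, Matrix.of_apply, hubbardCovarianceCT, hubbardTwoPointCT, hA, hB, sub_zero,
      neg_zero, mul_zero]

end Summit.HubbardSuperconductivity.HubbardSuperconductivity.Theorems.AposterioriCapRgSeededBrokenRegimeBoseFermiPinned
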